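import Mathlib
import Summits.ResolutionOfSingularities.ResolutionOfSingularities.Theorems.SyzygyFlatteningDefs
import Summits.ResolutionOfSingularities.ResolutionOfSingularities.Theorems.SyzygyFlatteningHigherRankTerminationLocalizedDatum
import Literature.AlgebraicGeometry.Resolution.SyzygySheaf
import Literature.AlgebraicGeometry.Resolution.ModuleBlowup
import HarnessLib

/-!
# A minimal chart datum base-changes along `B → k(X)·B`: `stub_baseChangedDatum`

Crux `HigherRankTermination` (stmt-ResolutionOfSingularities-17045), line `birth`, registered
stub `stub_baseChangedDatum` — the flat-base-change analogue of `stub_localizedDatum`.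

Setting: `k' = k(X) ⊆ K(X)`, `E = k(X)·B ⊆ K(X)` the base-changed model of `B ⊆ O ⊆ K`,
`ψ : B → E` the restriction of `K → K(X)`, `E` a localisation of `B[X]`, `J E = (J B) E`, same
syzygy index `n` (all hypotheses). A chart datum over `B` — a finite free resolution `(b, d, ε)`
of `B ⧸ J B`, an embedding `ι : Ω = range (d (n - 1)) → B^r` with torsion cokernel, an
`O`-minimal `r`-tuple `x` — is pushed to `E`:

* `baseChangedDatum_alg` (any flat `R → S`, `R → S` injective): `R ⧸ J → S ⧸ J S` is a base
  change (Mathlib `quotIdealMapEquivTensorQuot`), so the base-changed matrices resolve `S ⧸ J S`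
  (`FreeResolution.baseChange`) and the syzygy module base-changes (`isBaseChange_syzygyMap`,
  `f : Ω → Ω₁`); `ι₁ := ι ⊗ S : Ω₁ → S^r` (`IsBaseChange.lift`) is injective by flatness
  (`Module.Flat.lTensor_preserves_injective_linearMap` along `comp_isBaseChangeEquiv_eq`), has
  torsion cokernel (one nonzero multiplier for the standard basis of `R^r`, pushed through
  `R^r → S^r`), and every maximal minor `det (ι₁ g')` lies in the `S`-span of the old minors
  (`normIdeal_eq_map_of_span_eq_top`, as `f(Ω)` generates `Ω₁`).
* `baseChangedDatum_of` / `ratio_mem_of_mem_span`: dividing by `det (ι x)` in `K(X)`, each new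
  ratio `det (ι₁ g') / det (ι₁ x₁)` (`x₁ := f ∘ x`) lies in every subring containing `E` and the
  old ratios — applied to `O'` (minimality of `x₁`) and to `k'[image of B ∪ old ratios]`.

Sources: Matsumura §19 (after Lemma 4); Villamayor 2006, 1.1 and 3.4 (`[[M]]` base-changes).
-/

noncomputable section

-- single-problem summit: the doubled namespace component `ResolutionOfSingularities` is forced
set_option linter.dupNamespace false

namespace Summit.ResolutionOfSingularities.ResolutionOfSingularities.Theorems.SyzygyFlattening

open Function Literature.AlgebraicGeometry.Resolution

/-! ## Elementary lemmas -/

/-- A ring map commutes with the determinant of a matrix given by its entries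
(Mathlib `RingHom.map_det`). [folklore] -/
theorem ringHom_det_of {R R' : Type*} [CommRing R] [CommRing R'] (φ : R →+* R') {r : ℕ}
    (A : Fin r → Fin r → R) :
    φ (Matrix.det (Matrix.of fun i j => A i j)) = Matrix.det (Matrix.of fun i j => φ (A i j)) := by
  rw [RingHom.map_det, RingHom.mapMatrix_apply]
  rfl

/-- **Dividing a span relation.** Along ring maps `R → S → L` (`L` a field): if `y ∈ S` lies in
the ideal generated by the images of elements `δ t ∈ R`, then `y / D` lies in every subring `T`
of `L` containing the image of `S` and all the ratios `δ t / D`. [folklore] -/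
theorem ratio_mem_of_mem_span {R S L : Type*} [CommRing R] [CommRing S] [Field L] (ψ : R →+* S)
    (vS : S →+* L) {X : Type*} (δ : X → R) (D : L) (T : Subring L) (hS : ∀ s : S, vS s ∈ T)
    (hδ : ∀ t : X, vS (ψ (δ t)) * D⁻¹ ∈ T) {y : S}
    (hy : y ∈ Ideal.span (Set.range fun t : X => ψ (δ t))) : vS y * D⁻¹ ∈ T := by
  refine Submodule.span_induction (p := fun y _ => vS y * D⁻¹ ∈ T) ?_ ?_ ?_ ?_ hy
  · rintro _ ⟨t, rfl⟩
    exact hδ t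
  · rw [map_zero, zero_mul]
    exact T.zero_mem
  · intro y₁ y₂ _ _ h₁ h₂
    rw [map_add, add_mul]
    exact T.add_mem h₁ h₂
  · intro s y _ h
    rw [smul_eq_mul, map_mul, mul_assoc]
    exact T.mul_mem (hS s) h

/-- **Torsion cokernels survive base change.** If `ι : M → R^r` has torsion cokernel (`R` a
domain), `ι₁ : M₁ → S^r` is `S`-linear with `ι₁ ∘ f = ι ⊗ S` entrywise and `R → S` is injective,
then `ι₁` has torsion cokernel: a common nonzero multiplier `a = ∏ aⱼ` pushes the whole of `R^r`
into `range ι`, hence (`S^r` being generated by `R^r`) `a · S^r ⊆ range ι₁`. [folklore] -/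
theorem exists_smul_mem_range_of_baseChange {R S : Type*} [CommRing R] [IsDomain R] [CommRing S]
    [Algebra R S] (hRS : Function.Injective (algebraMap R S)) {M M₁ : Type*} [AddCommGroup M]
    [Module R M] [AddCommGroup M₁] [Module R M₁] [Module S M₁] [IsScalarTower R S M₁] {r : ℕ}
    (ι : M →ₗ[R] (Fin r → R)) (ι₁ : M₁ →ₗ[S] (Fin r → S)) (f : M →ₗ[R] M₁)
    (happ : ∀ m j, ι₁ (f m) j = algebraMap R S (ι m j))
    (htors : ∀ z : Fin r → R, ∃ a : R, a ≠ 0 ∧ a • z ∈ LinearMap.range ι) :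
    ∀ z : Fin r → S, ∃ a : S, a ≠ 0 ∧ a • z ∈ LinearMap.range ι₁ := by
  classical
  choose a ha hmem using fun j : Fin r => htors (Pi.single j 1)
  have hA0 : (∏ j, a j) ≠ 0 := Finset.prod_ne_zero_iff.mpr fun j _ => ha j
  -- the common multiplier pushes all of `R^r` into `range ι`
  have hR : ∀ v : Fin r → R, (∏ j, a j) • v ∈ LinearMap.range ι := fun v => by
    rw [pi_eq_sum_univ' v, Finset.smul_sum]
    refine Submodule.sum_mem _ fun j _ => ?_
    rw [smul_comm, ← Finset.prod_erase_mul Finset.univ a (Finset.mem_univ j), mul_smul]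
    exact Submodule.smul_mem _ _ (Submodule.smul_mem _ _ (hmem j))
  intro z
  refine ⟨algebraMap R S (∏ j, a j), fun h => hA0 (hRS (h.trans (map_zero _).symm)), ?_⟩
  refine (isBaseChange_piAlgebraMap R S r).inductionOn z
    (fun z => algebraMap R S (∏ j, a j) • z ∈ LinearMap.range ι₁) (by
      rw [smul_zero]; exact Submodule.zero_mem _) (fun v => ?_) (fun s w hw => ?_)
    fun w₁ w₂ h₁ h₂ => ?_
  · obtain ⟨m, hm⟩ := hR v
    rw [algebraMap_smul, ← LinearMap.map_smul_of_tower, ← hm]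
    exact ⟨f m, funext fun j => happ m j⟩
  · rw [smul_comm]
    exact Submodule.smul_mem _ s hw
  · rw [smul_add]
    exact Submodule.add_mem _ h₁ h₂

/-! ## The algebraic heart: base change of a chart datum along a flat extension -/

/-- **Base change of a chart datum along a flat ring extension `R → S`** (abstract form). Given
a finite free resolution `(b, d, ε)` of `R ⧸ J`, an injective `ι : Ω = range (d n) → R^r` with
torsion cokernel (`R` a domain, `R → S` injective and flat) and `J₁ = J S`: the base-changed
matrices `d₁` resolve `S ⧸ J₁` (`FreeResolution.baseChange`, the quotient `R ⧸ J → S ⧸ J S`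
being a base change), the syzygy module base-changes (`f : Ω → Ω₁ = range (d₁ n)`,
`isBaseChange_syzygyMap`), `ι` extends to an injective `ι₁ = ι ⊗ S : Ω₁ → S^r` with torsion
cokernel, `ι₁ ∘ f = ι` entrywise, and every maximal minor of `ι₁` lies in the ideal generated
by the (images of the) maximal minors of `ι` (`normIdeal_eq_map_of_span_eq_top`).
[cite: Matsumura1987, §19 (after Lemma 4); Villamayoru2006, 3.4] -/
theorem baseChangedDatum_alg {R S : Type*} [CommRing R] [IsDomain R] [CommRing S] [Algebra R S]
    [Module.Flat R S] (hRS : Function.Injective (algebraMap R S))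
    (J : Ideal R) (J₁ : Ideal S) (hJ : J₁ = J.map (algebraMap R S)) (n : ℕ) (b : ℕ → ℕ)
    (d : (i : ℕ) → ((Fin (b (i + 1)) → R) →ₗ[R] (Fin (b i) → R)))
    (ε : (Fin (b 0) → R) →ₗ[R] (R ⧸ J)) (r : ℕ)
    (ι : ↥(LinearMap.range (d n)) →ₗ[R] (Fin r → R))
    (hε : Function.Surjective ε) (h0 : Function.Exact (d 0) ε)
    (hs : ∀ i : ℕ, Function.Exact (d (i + 1)) (d i)) (hι : Function.Injective ι)
    (htors : ∀ z : Fin r → R, ∃ a : R, a ≠ 0 ∧ a • z ∈ LinearMap.range ι) :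
    ∃ (d₁ : (i : ℕ) → ((Fin (b (i + 1)) → S) →ₗ[S] (Fin (b i) → S)))
      (ε₁ : (Fin (b 0) → S) →ₗ[S] (S ⧸ J₁))
      (ι₁ : ↥(LinearMap.range (d₁ n)) →ₗ[S] (Fin r → S))
      (f : ↥(LinearMap.range (d n)) →ₗ[R] ↥(LinearMap.range (d₁ n))),
      (Function.Surjective ε₁ ∧ Function.Exact (d₁ 0) ε₁ ∧
          (∀ i : ℕ, Function.Exact (d₁ (i + 1)) (d₁ i)) ∧ Function.Injective ι₁ ∧
          (∀ z : Fin r → S, ∃ a : S, a ≠ 0 ∧ a • z ∈ LinearMap.range ι₁)) ∧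
      (∀ (m : ↥(LinearMap.range (d n))) (j : Fin r), ι₁ (f m) j = algebraMap R S (ι m j)) ∧
      (∀ g' : Fin r → ↥(LinearMap.range (d₁ n)),
        Matrix.det (Matrix.of fun i j => ι₁ (g' i) j) ∈
          Ideal.span (Set.range fun g : Fin r → ↥(LinearMap.range (d n)) =>
            algebraMap R S (Matrix.det (Matrix.of fun i j => ι (g i) j)))) := by
  subst hJ
  -- (1) the resolved module base-changes: `R ⧸ J → S ⧸ J S` is `(R ⧸ J) ⊗ S`
  set φ : (R ⧸ J) →ₗ[R] (S ⧸ J.map (algebraMap R S)) :=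
    (Ideal.quotientMapₐ (J.map (algebraMap R S)) (Algebra.ofId R S)
      fun a ha => Ideal.mem_comap.mpr (Ideal.mem_map_of_mem (algebraMap R S) ha)).toLinearMap
    with hφdef
  have hφmk : ∀ a : R, φ (Ideal.Quotient.mk J a) =
      Ideal.Quotient.mk (J.map (algebraMap R S)) (algebraMap R S a) := fun a => by
    rw [hφdef, AlgHom.toLinearMap_apply, Ideal.quotient_map_mkₐ, Ideal.Quotient.mkₐ_eq_mk,
      Algebra.ofId_apply]
  have hφ : IsBaseChange S φ := by
    refine IsBaseChange.of_equiv
      (Algebra.TensorProduct.quotIdealMapEquivTensorQuot S J).toLinearEquiv.symm fun y => ?_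
    obtain ⟨a, rfl⟩ := Ideal.Quotient.mk_surjective y
    rw [hφmk, ← AlgEquiv.toLinearEquiv_symm, AlgEquiv.coe_toLinearEquiv,
      Algebra.TensorProduct.quotIdealMapEquivTensorQuot_symm_tmul, Algebra.smul_def, mul_one]
    rfl
  -- (2) the resolution and its flat base change
  set F : FreeResolution R (R ⧸ J) := ⟨b, d, ε, hε, h0, hs⟩ with hFdef
  -- (3) the syzygy module base-changes; the extended framing `ι₁ = ι ⊗ S`
  have hf : IsBaseChange S (F.syzygyMap S φ hφ n) := F.isBaseChange_syzygyMap S φ hφ n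
  set ι₁ : ↥((F.baseChange S φ hφ).syzygy n) →ₗ[S] (Fin r → S) :=
    hf.lift (piAlgebraMap R S r ∘ₗ ι) with hι₁def
  have happ : ∀ (m : ↥(LinearMap.range (d n))) (j : Fin r),
      ι₁ (F.syzygyMap S φ hφ n m) j = algebraMap R S (ι m j) := fun m j => by
    rw [hι₁def, hf.lift_eq]
    rfl
  have happ' : ∀ m : ↥(LinearMap.range (d n)),
      ι₁ (F.syzygyMap S φ hφ n m) = algebraMap R S ∘ ι m := fun m => funext (happ m)
  refine ⟨(F.baseChange S φ hφ).d, (F.baseChange S φ hφ).ε, ι₁, F.syzygyMap S φ hφ n,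
    ⟨(F.baseChange S φ hφ).ε_surjective, (F.baseChange S φ hφ).exact_zero,
      (F.baseChange S φ hφ).exact_succ, ?_, ?_⟩, happ, ?_⟩
  · -- injectivity: `ι₁` is `ι ⊗ S` up to the canonical isomorphisms, and `S` is flat
    have hsq := comp_isBaseChangeEquiv_eq (f := ι) (f' := ι₁) (F.syzygyMap S φ hφ n)
      (piAlgebraMap R S r) (LinearMap.ext fun m => (happ' m).symm) hf
      (isBaseChange_piAlgebraMap R S r)
    have h1 : Function.Injective (ι₁ ∘ₗ hf.equiv.toLinearMap) := by
      rw [hsq, LinearMap.coe_comp]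
      refine (isBaseChange_piAlgebraMap R S r).equiv.injective.comp ?_
      rw [LinearMap.baseChange_eq_ltensor]
      exact Module.Flat.lTensor_preserves_injective_linearMap ι hι
    intro y₁ y₂ hy
    refine hf.equiv.symm.injective (h1 ?_)
    simpa only [LinearMap.comp_apply, LinearEquiv.coe_coe, LinearEquiv.apply_symm_apply] using hy
  · -- torsion cokernel
    exact exists_smul_mem_range_of_baseChange hRS ι ι₁ (F.syzygyMap S φ hφ n) happ htors
  · -- maximal minors: `[[Ω₁]]_{ι₁} = [[Ω]]_ι S` since `f(Ω)` generates `Ω₁`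
    have hspan : Submodule.span S (Set.range (F.syzygyMap S φ hφ n)) = ⊤ := by
      refine Submodule.eq_top_iff'.mpr fun y => ?_
      refine hf.inductionOn y _ (Submodule.zero_mem _) (fun m => Submodule.subset_span ⟨m, rfl⟩)
        (fun s w hw => Submodule.smul_mem _ s hw) fun w₁ w₂ h₁ h₂ => Submodule.add_mem _ h₁ h₂
    have hnorm := normIdeal_eq_map_of_span_eq_top (F.syzygyMap S φ hφ n) hspan ι ι₁ happ'
    intro g'
    have hmem : (frameMatrix ι₁ g').det ∈ normIdeal ι₁ := det_mem_normIdeal ι₁ g'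
    rw [hnorm, normIdeal, Ideal.map_span, ← Set.range_comp] at hmem
    exact hmem

/-! ## The datum over abstract coordinate rings `R → K`, `S → L` -/

/-- **Base change of a minimal chart datum, abstract coordinates.** `R ⊆ K` and `S ⊆ L` via
ring maps `vR` (injective), `vS`; `φ : K → L` a field map with `φ(O) ⊆ O'`, `k' ⊆ O'`;
`ψ : R → S` the restriction of `φ`; `S` a localisation of `R[X]` along `ψ` (hence `R`-flat);
`J₁ = J S`; `Es ⊇ vS(S)`, `Es = k'[φ(Bs)]`, `Bs ⊆ vR(R) ∩ O`. Then an `O`-minimal datum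
`(b, d, ε, ι, x)` over `R` yields (`baseChangedDatum_alg`) one over `S` with `x₁ = f ∘ x`,
`det (vS ∘ ι₁ x₁) = φ (det (vR ∘ ι x)) ≠ 0`, `x₁` `O'`-minimal, and
`k'[Es ∪ new ratios] = k'[φ(Bs ∪ old ratios)]`. [cite: Matsumura1987, §19 (after Lemma 4)] -/
theorem baseChangedDatum_of {k' K L : Type} {R S : Type*} [Field k'] [Field K] [Field L]
    [Algebra k' L] [CommRing R] [IsDomain R] [CommRing S] (O : ValuationSubring K)
    (O' : ValuationSubring L)
    (φ : K →+* L) (vR : R →+* K) (vS : S →+* L) (hvR : Function.Injective vR)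
    (hOO' : ∀ x : K, x ∈ O → φ x ∈ O') (hk'O' : ∀ g : k', algebraMap k' L g ∈ O')
    (Bs : Set K) (Es : Set L) (hBs : ∀ y ∈ Bs, ∃ b : R, vR b = y) (hEs : ∀ s : S, vS s ∈ Es)
    (hE : Es = ((Algebra.adjoin k' (φ '' Bs) : Subalgebra k' L) : Set L))
    (hBO : ∀ y ∈ Bs, y ∈ O) (ψ : R →+* S) (XE : S) (M : Submonoid (Polynomial R))
    (hψ : ∀ b : R, vS (ψ b) = φ (vR b))
    (hloc : @IsLocalization (Polynomial R) _ M S _ (Polynomial.eval₂RingHom ψ XE).toAlgebra)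
    (J : Ideal R) (J₁ : Ideal S) (hJ : J₁ = J.map ψ) (n n₁ : ℕ) (hidx : n₁ = n) (b : ℕ → ℕ)
    (d : (i : ℕ) → ((Fin (b (i + 1)) → R) →ₗ[R] (Fin (b i) → R)))
    (ε : (Fin (b 0) → R) →ₗ[R] (R ⧸ J)) (r : ℕ)
    (ι : ↥(LinearMap.range (d (n - 1))) →ₗ[R] (Fin r → R))
    (x : Fin r → ↥(LinearMap.range (d (n - 1)))) (hε : Function.Surjective ε)
    (h0 : Function.Exact (d 0) ε) (hs : ∀ i : ℕ, Function.Exact (d (i + 1)) (d i))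
    (hι : Function.Injective ι)
    (htors : ∀ z : Fin r → R, ∃ a : R, a ≠ 0 ∧ a • z ∈ LinearMap.range ι)
    (hx : Matrix.det (Matrix.of fun i j => vR (ι (x i) j)) ≠ 0)
    (hmin : ∀ g' : Fin r → ↥(LinearMap.range (d (n - 1))),
      Matrix.det (Matrix.of fun i j => vR (ι (g' i) j)) *
        (Matrix.det (Matrix.of fun i j => vR (ι (x i) j)))⁻¹ ∈ O) :
    ∃ (b₁ : ℕ → ℕ) (d₁ : (i : ℕ) → ((Fin (b₁ (i + 1)) → S) →ₗ[S] (Fin (b₁ i) → S)))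
      (ε₁ : (Fin (b₁ 0) → S) →ₗ[S] (S ⧸ J₁)) (r₁ : ℕ)
      (ι₁ : ↥(LinearMap.range (d₁ (n₁ - 1))) →ₗ[S] (Fin r₁ → S))
      (x₁ : Fin r₁ → ↥(LinearMap.range (d₁ (n₁ - 1)))),
      (Function.Surjective ε₁ ∧ Function.Exact (d₁ 0) ε₁ ∧
          (∀ i : ℕ, Function.Exact (d₁ (i + 1)) (d₁ i)) ∧ Function.Injective ι₁ ∧
          (∀ z : Fin r₁ → S, ∃ a : S, a ≠ 0 ∧ a • z ∈ LinearMap.range ι₁)) ∧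
        Matrix.det (Matrix.of fun i j => vS (ι₁ (x₁ i) j)) ≠ 0 ∧
        (∀ g' : Fin r₁ → ↥(LinearMap.range (d₁ (n₁ - 1))),
          Matrix.det (Matrix.of fun i j => vS (ι₁ (g' i) j)) *
            (Matrix.det (Matrix.of fun i j => vS (ι₁ (x₁ i) j)))⁻¹ ∈ O') ∧
        Algebra.adjoin k' (Es ∪
            {y : L | ∃ g : Fin r₁ → ↥(LinearMap.range (d₁ (n₁ - 1))),
              y = Matrix.det (Matrix.of fun i j => vS (ι₁ (g i) j)) *
                (Matrix.det (Matrix.of fun i j => vS (ι₁ (x₁ i) j)))⁻¹}) =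
          Algebra.adjoin k' (φ '' (Bs ∪
            {y : K | ∃ g : Fin r → ↥(LinearMap.range (d (n - 1))),
              y = Matrix.det (Matrix.of fun i j => vR (ι (g i) j)) *
                (Matrix.det (Matrix.of fun i j => vR (ι (x i) j)))⁻¹})) := by
  subst n₁
  -- (0) `S` as an `R`-algebra along `ψ`: `ψ` injective, `S` flat (a localisation of `R[X]`)
  letI : Algebra R S := ψ.toAlgebra
  have hψinj : Function.Injective (algebraMap R S) := fun b₁ b₂ h => by
    apply hvR
    apply φ.injective
    rw [← hψ, ← hψ]
    exact congrArg vS h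
  letI algX : Algebra (Polynomial R) S := (Polynomial.eval₂RingHom ψ XE).toAlgebra
  haveI : IsLocalization M S := hloc
  haveI : IsScalarTower R (Polynomial R) S := IsScalarTower.of_algebraMap_eq fun b' => by
    show ψ b' = Polynomial.eval₂ ψ XE (algebraMap R (Polynomial R) b')
    rw [Polynomial.algebraMap_eq, Polynomial.eval₂_C]
  haveI : Module.Flat (Polynomial R) S := IsLocalization.flat S M
  haveI : Module.Flat R (Polynomial R) := Module.Flat.of_free
  haveI : Module.Flat R S := Module.Flat.trans R (Polynomial R) S
  -- `S ⊆ O'` (`Es = k'[φ(Bs)]`, `k' ⊆ O'`, `φ(Bs) ⊆ φ(O) ⊆ O'`)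
  have hEO' : ∀ s : S, vS s ∈ O' := fun s => by
    have h := hEs s
    rw [hE] at h
    exact adjoin_toSubring_le_valuationSubring O' hk'O'
      (by rintro _ ⟨y, hy, rfl⟩; exact hOO' y (hBO y hy)) h
  -- (1)–(3) the algebraic construction along `R → S`
  have hJ' : J₁ = J.map (algebraMap R S) := hJ
  obtain ⟨d₁, ε₁, ι₁, f, hfive, happ, hspan⟩ :=
    baseChangedDatum_alg hψinj J J₁ hJ' (n - 1) b d ε r ι hε h0 hs hι htors
  -- (4) the `L`-valued maximal minors of `f ∘ g` are the `K`-valued ones of `g`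
  have hdetf : ∀ g : Fin r → ↥(LinearMap.range (d (n - 1))),
      Matrix.det (Matrix.of fun i j => vS (ι₁ (f (g i)) j)) =
        φ (Matrix.det (Matrix.of fun i j => vR (ι (g i) j))) := fun g => by
    rw [ringHom_det_of φ]
    congr 1
    ext i j
    rw [Matrix.of_apply, Matrix.of_apply, happ, ← hψ]
    rfl
  have hdetK : ∀ g : Fin r → ↥(LinearMap.range (d (n - 1))),
      vS (ψ (Matrix.det (Matrix.of fun i j => ι (g i) j))) =
        φ (Matrix.det (Matrix.of fun i j => vR (ι (g i) j))) := fun g => by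
    rw [← RingHom.comp_apply, ringHom_det_of, ringHom_det_of]
    congr 1
    ext i j
    rw [Matrix.of_apply, Matrix.of_apply, RingHom.comp_apply, hψ]
  -- (5) new ratios lie in every subring containing `vS(S)` and the `φ`-images of the old ratios
  have hratio : ∀ T : Subring L, (∀ s : S, vS s ∈ T) →
      (∀ g : Fin r → ↥(LinearMap.range (d (n - 1))),
        φ (Matrix.det (Matrix.of fun i j => vR (ι (g i) j)) *
          (Matrix.det (Matrix.of fun i j => vR (ι (x i) j)))⁻¹) ∈ T) →
      ∀ g' : Fin r → ↥(LinearMap.range (d₁ (n - 1))),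
        Matrix.det (Matrix.of fun i j => vS (ι₁ (g' i) j)) *
          (Matrix.det (Matrix.of fun i j => vS (ι₁ (f (x i)) j)))⁻¹ ∈ T := by
    intro T hT hold g'
    rw [hdetf x]
    have key := ratio_mem_of_mem_span ψ vS
      (fun g : Fin r → ↥(LinearMap.range (d (n - 1))) =>
        Matrix.det (Matrix.of fun i j => ι (g i) j))
      (φ (Matrix.det (Matrix.of fun i j => vR (ι (x i) j)))) T hT
      (fun g => by rw [hdetK g]; simpa only [map_mul, map_inv₀] using hold g) (hspan g')
    rwa [ringHom_det_of] at key
  refine ⟨b, d₁, ε₁, r, ι₁, fun i => f (x i), hfive, ?_, ?_, ?_⟩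
  · -- `det (ι₁ x₁) = φ (det (ι x)) ≠ 0`
    rw [hdetf x]
    exact (map_ne_zero φ).mpr hx
  · -- `O'`-minimality of `x₁`
    intro g'
    exact hratio O'.toSubring hEO' (fun g => hOO' _ (hmin g)) g'
  · -- the chart algebra over `S` is generated by the images of `Bs` and of the old ratios
    set C : Subalgebra k' L := Algebra.adjoin k' (φ '' (Bs ∪
      {y : K | ∃ g : Fin r → ↥(LinearMap.range (d (n - 1))),
        y = Matrix.det (Matrix.of fun i j => vR (ι (g i) j)) *
          (Matrix.det (Matrix.of fun i j => vR (ι (x i) j)))⁻¹})) with hC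
    apply le_antisymm
    · have hERHS : Es ⊆ C := by
        rw [hE, hC]
        exact Algebra.adjoin_mono (Set.image_mono Set.subset_union_left)
      refine Algebra.adjoin_le ?_
      rintro y (hy | ⟨g', rfl⟩)
      · exact hERHS hy
      · refine hratio C.toSubring (fun s => hERHS (hEs s)) (fun g => ?_) g'
        rw [hC]
        exact Algebra.subset_adjoin ⟨_, Or.inr ⟨g, rfl⟩, rfl⟩
    · refine Algebra.adjoin_le ?_
      rintro _ ⟨y, hy | ⟨g, rfl⟩, rfl⟩
      · refine Algebra.subset_adjoin (Or.inl ?_)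
        obtain ⟨b', rfl⟩ := hBs y hy
        rw [← hψ]
        exact hEs _
      · refine Algebra.subset_adjoin (Or.inr ⟨fun i => f (g i), ?_⟩)
        rw [hdetf g, hdetf x, map_mul, map_inv₀]

/-! ## The registered stub -/

/-- **STUB `stub_baseChangedDatum` (a minimal datum base-changes along `B → E = k(X)·B`).** For
`B ⊆ O ⊆ K`, `E = k'·B ⊆ K(X)` a localisation of `B[X]` along `ψ = (K → K(X))|_B`,
`J E = (J B) E`, same syzygy index: an `O`-minimal datum `(F, ι, x)` over `B` base-changes along
the flat injective `ψ` to a datum `(F₁, ι₁, x₁ = x ⊗ 1)` over `E` with `det (ι₁ x₁) ≠ 0`, `x₁`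
`O'`-minimal, and `E[new ratios] = k'[images of B and of the old ratios]` (`baseChangedDatum_of`
in the coordinates `B ⊆ K`, `E ⊆ K(X)`). [cite: Matsumura1987, §19 (after Lemma 4); Villamayoru2006, 3.4] -/
theorem stub_baseChangedDatum : ∀ (k K : Type) [Field k] [Field K] [Algebra k K]
    (O : ValuationSubring K) (O' : ValuationSubring (RatFunc K)),
    ∀ (k' : Type) [Field k'] [Algebra k k'] [Algebra k' (RatFunc K)] [IsScalarTower k k' (RatFunc K)],
      Set.range (algebraMap k' (RatFunc K)) =
        ((IntermediateField.adjoin k {(RatFunc.X : RatFunc K)} : IntermediateField k (RatFunc K)) :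
          Set (RatFunc K)) →
    (∀ x : K, x ∈ O → algebraMap K (RatFunc K) x ∈ O') → (∀ g : k', algebraMap k' (RatFunc K) g ∈ O') →
    ∀ (B : Subalgebra k K) (E : Subalgebra k' (RatFunc K)),
      E = Algebra.adjoin k' ((algebraMap K (RatFunc K)) '' (B : Set K)) → B.toSubring ≤ O.toSubring →
    ∀ (ψ : ↥B →+* ↥E) (XE : ↥E),
      (∀ b : ↥B, (ψ b : RatFunc K) = algebraMap K (RatFunc K) b) → (XE : RatFunc K) = RatFunc.X →
      @IsLocalization (Polynomial ↥B) _
        ((nonZeroDivisors (Polynomial k)).map (Polynomial.mapRingHom (algebraMap k ↥B)))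
        ↥E _ (Polynomial.eval₂RingHom ψ XE).toAlgebra →
      singIdeal E = (singIdeal B).map ψ → syzygyIndex k' (RatFunc K) = syzygyIndex k K →
    ∀ (b : ℕ → ℕ) (d : (i : ℕ) → ((Fin (b (i + 1)) → ↥B) →ₗ[↥B] (Fin (b i) → ↥B)))
      (ε : (Fin (b 0) → ↥B) →ₗ[↥B] (↥B ⧸ singIdeal B)) (r : ℕ)
      (ι : ↥(LinearMap.range (d (syzygyIndex k K - 1))) →ₗ[↥B] (Fin r → ↥B))
      (x : Fin r → ↥(LinearMap.range (d (syzygyIndex k K - 1)))),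
      Function.Surjective ε → Function.Exact (d 0) ε → (∀ i : ℕ, Function.Exact (d (i + 1)) (d i)) →
      Function.Injective ι → (∀ z : Fin r → ↥B, ∃ a : ↥B, a ≠ 0 ∧ a • z ∈ LinearMap.range ι) →
      Matrix.det (Matrix.of fun i j => ((ι (x i) j : ↥B) : K)) ≠ 0 →
      (∀ g' : Fin r → ↥(LinearMap.range (d (syzygyIndex k K - 1))),
        Matrix.det (Matrix.of fun i j => ((ι (g' i) j : ↥B) : K)) *
          (Matrix.det (Matrix.of fun i j => ((ι (x i) j : ↥B) : K)))⁻¹ ∈ O) →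
      ∃ (b₁ : ℕ → ℕ) (d₁ : (i : ℕ) → ((Fin (b₁ (i + 1)) → ↥E) →ₗ[↥E] (Fin (b₁ i) → ↥E)))
        (ε₁ : (Fin (b₁ 0) → ↥E) →ₗ[↥E] (↥E ⧸ singIdeal E)) (r₁ : ℕ)
        (ι₁ : ↥(LinearMap.range (d₁ (syzygyIndex k' (RatFunc K) - 1))) →ₗ[↥E] (Fin r₁ → ↥E))
        (x₁ : Fin r₁ → ↥(LinearMap.range (d₁ (syzygyIndex k' (RatFunc K) - 1)))),
        (Function.Surjective ε₁ ∧ Function.Exact (d₁ 0) ε₁ ∧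
            (∀ i : ℕ, Function.Exact (d₁ (i + 1)) (d₁ i)) ∧ Function.Injective ι₁ ∧
            (∀ z : Fin r₁ → ↥E, ∃ a : ↥E, a ≠ 0 ∧ a • z ∈ LinearMap.range ι₁)) ∧
          Matrix.det (Matrix.of fun i j => ((ι₁ (x₁ i) j : ↥E) : RatFunc K)) ≠ 0 ∧
          (∀ g' : Fin r₁ → ↥(LinearMap.range (d₁ (syzygyIndex k' (RatFunc K) - 1))),
            Matrix.det (Matrix.of fun i j => ((ι₁ (g' i) j : ↥E) : RatFunc K)) *
              (Matrix.det (Matrix.of fun i j => ((ι₁ (x₁ i) j : ↥E) : RatFunc K)))⁻¹ ∈ O') ∧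
          Algebra.adjoin k' ((E : Set (RatFunc K)) ∪
              {y : RatFunc K | ∃ g : Fin r₁ → ↥(LinearMap.range (d₁ (syzygyIndex k' (RatFunc K) - 1))),
                y = Matrix.det (Matrix.of fun i j => ((ι₁ (g i) j : ↥E) : RatFunc K)) *
                  (Matrix.det (Matrix.of fun i j => ((ι₁ (x₁ i) j : ↥E) : RatFunc K)))⁻¹}) =
            Algebra.adjoin k' ((algebraMap K (RatFunc K)) '' ((B : Set K) ∪
              {y : K | ∃ g : Fin r → ↥(LinearMap.range (d (syzygyIndex k K - 1))),
                y = Matrix.det (Matrix.of fun i j => ((ι (g i) j : ↥B) : K)) *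
                  (Matrix.det (Matrix.of fun i j => ((ι (x i) j : ↥B) : K)))⁻¹})) := by
  intro k K _ _ _ O O' k' _ _ _ _ _ hOO' hk'O' B E hE hBO ψ XE hψ _ hloc hJ hidx b d ε r ι x hε h0
    hs hι htors hx hmin
  exact baseChangedDatum_of O O' (algebraMap K (RatFunc K)) (SubringClass.subtype B)
    (SubringClass.subtype E) Subtype.val_injective hOO' hk'O' (B : Set K) (E : Set (RatFunc K))
    (fun y hy => ⟨⟨y, hy⟩, rfl⟩) (fun s => s.2) (congrArg SetLike.coe hE) (fun y hy => hBO hy) ψ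
    XE _ hψ hloc (singIdeal B) (singIdeal E) hJ (syzygyIndex k K) (syzygyIndex k' (RatFunc K))
    hidx b d ε r ι x hε h0 hs hι htors hx hmin

end Summit.ResolutionOfSingularities.ResolutionOfSingularities.Theorems.SyzygyFlattening

end
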